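import Summits.HodgeConjecture.CorCM.Census.QuarticTwistCount

/-!
# The quartic twist `(ℤ/4 × B, (2,0))`, IX: THE LAW — no family of fewer than `β − 1` Galois orbits generates, so
# `μ(ℤ/4 × B) = β − 1` EXACTLY for every finite group `B` of odd order `≥ 3`

COR-CM (cell `pub-hodgecm2`), count-neutral kernel combinatorics by the binder seat b09 (gen 32; lane QUARTIC-TWIST), part IX, sequel of
`Census/QuarticTwistCount.lean`.  Two bookkeeping definitions (`orbSet`, `parVec` — the block parities, as in b23's `Census/EvenSliceLaw.lean`
and the seat's `Census/BlockParityLaw.lean`) + theorems; no `decide` table, no certificate, no named fact, no geometry, no `sorry`.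
HONEST FRAMING: `HC_CM` is NOT proved, here or anywhere in the tree; nothing here is a headline and nothing here produces a period.

THE LAW (**`card_orb_le_card_add_one`**, `|B|` odd `≥ 3`).  If a finite family `S` of exponent vectors generates the Hodge lattice of the
quartic twist together with the pairs and all Galois translates — `hodge B ≤ pairs B ⊔ ℤ⟨transl g v : g, v ∈ S⟩` — then `β ≤ |S| + 1`.
PROOF: the BLOCK PARITIES `parVec m = (Σ_{s ∈ ω} m(s) mod 2)_ω` kill the pairs (`s`, `s + 2` share a block) and are invariant under
translation, so the parities of `pairs ⊔ ℤ[G]·S` span at most `|S|` dimensions over `𝔽₂`; on the other hand `H` contains `β − 1` vectors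
with INDEPENDENT parities: one `Φ`-decreasing cross square per non-residual block (unitriangular for the `Φ`-order: the three minor
corners have smaller potential, hence lie in other blocks), the column face at a constant type (parity `1` on all four residual blocks),
a Boolean pair difference `X` (parity `1` on the blocks of `u ± δ`) and a Weil vector `w` (parity `1` on the blocks of `u`, `u − δ`, as
`|B|` is odd).  With part VIII (**`quarticTwist_law_eq`**): the least number of Galois orbits of generators of the Hodge lattice of the
quartic twist modulo divisor classes is EXACTLY `β − 1`, attained by rank-four faces — the model-intrinsic form of `μ = φ₂ = β − 1`
(gen 29/31: `φ₂ + 1 + [n even] = β + d₂(G/𝒦)`, here `n = 2|B|` even and `d₂ = 1`).  All [folklore].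

## References
* [Pohlmann1968] H. Pohlmann, Algebraic cycles on abelian varieties of complex multiplication type, Ann. of Math. 88 (1968), Thm 1.
* [Milne1999] J. S. Milne, Lefschetz motives and the Tate conjecture, Compositio Math. 117 (1999), Prop. 2.1, p. 54.
-/

namespace Summit.HodgeConjecture.CorCM.Census.QuarticTwist

open Finset

variable (B : Type) [AddGroup B] [Fintype B] [DecidableEq B]

/-- Equality of blocks is decided classically (bookkeeping). [folklore] -/
noncomputable instance instDecidableEqOrb : DecidableEq (Orb B) := Classical.decEq _

/-! ## §1 Block sets and block parities -/

/-- The labels of the block `ω`, as a finite set. [folklore] -/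
noncomputable def orbSet (ω : Orb B) : Finset (Ty B) := univ.filter fun s => (Quotient.mk (orbitRel B) s : Orb B) = ω

/-- Membership in `orbSet`. [folklore] -/
theorem mem_orbSet {ω : Orb B} {s : Ty B} : s ∈ orbSet B ω ↔ (Quotient.mk (orbitRel B) s : Orb B) = ω := by
  unfold orbSet; simp only [mem_filter, mem_univ, true_and]

/-- Twists preserve block sets. [folklore] -/
theorem tw_mem_orbSet_iff (g : ZMod 4 × B) {ω : Orb B} {s : Ty B} : tw B g s ∈ orbSet B ω ↔ s ∈ orbSet B ω := by
  rw [mem_orbSet, mem_orbSet]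
  have h : (Quotient.mk (orbitRel B) (tw B g s) : Orb B) = Quotient.mk (orbitRel B) s := Quotient.sound ⟨-g, tw_neg_tw B g s⟩
  rw [h]

/-- `Φ` is constant on a block. [folklore] -/
theorem Phi_eq_of_mem_orbSet {ω : Orb B} {s s' : Ty B} (hs : s ∈ orbSet B ω) (hs' : s' ∈ orbSet B ω) : Phi B s = Phi B s' := by
  rw [mem_orbSet] at hs hs'
  obtain ⟨g, rfl⟩ := Quotient.exact (hs.trans hs'.symm)
  rw [Phi_tw]

/-- **The block parities** `parVec m = (Σ_{s ∈ ω} m(s) mod 2)_ω`, a `ℤ`-linear map to `𝔽₂^{Orb}`. [folklore] -/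
noncomputable def parVec : (Ty B → ℤ) →ₗ[ℤ] (Orb B → ZMod 2) where
  toFun m := fun ω => ∑ s ∈ orbSet B ω, (m s : ZMod 2)
  map_add' m m' := by
    funext ω
    simp only [Pi.add_apply, Int.cast_add, Finset.sum_add_distrib]
  map_smul' c m := by
    funext ω
    simp only [Pi.smul_apply, smul_eq_mul, Int.cast_mul, RingHom.id_apply, Finset.mul_sum, zsmul_eq_mul]

/-- `parVec` evaluated. [folklore] -/
theorem parVec_apply (m : Ty B → ℤ) (ω : Orb B) : parVec B m ω = ∑ s ∈ orbSet B ω, (m s : ZMod 2) := rfl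

/-- `parVec` of a unit vector: the indicator of the block of its label. [folklore] -/
theorem parVec_single (s : Ty B) (c : ℤ) (ω : Orb B) :
    parVec B (Pi.single s c) ω = if s ∈ orbSet B ω then (c : ZMod 2) else 0 := by
  rw [parVec_apply]
  have hterm : ∀ s' ∈ orbSet B ω, ((Pi.single s c : Ty B → ℤ) s' : ZMod 2) = if s = s' then (c : ZMod 2) else 0 := by
    intro s' _
    rw [Pi.single_apply]
    by_cases h : s' = s
    · rw [if_pos h, if_pos h.symm]
    · rw [if_neg h, if_neg (Ne.symm h), Int.cast_zero]
  rw [Finset.sum_congr rfl hterm, Finset.sum_ite_eq]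

/-- **`parVec` kills the pairs** (`s` and `s + 2 = (2,0)·s` lie in the same block). [folklore] -/
theorem parVec_pairVec (s : Ty B) : parVec B (pairVec B s) = 0 := by
  funext ω
  unfold pairVec
  have h2 : s + 2 ∈ orbSet B ω ↔ s ∈ orbSet B ω := by rw [← tw_two_zero]; exact tw_mem_orbSet_iff B (2, 0)
  rw [map_add, Pi.add_apply, parVec_single, parVec_single, Pi.zero_apply]
  by_cases h : s ∈ orbSet B ω
  · rw [if_pos h, if_pos (h2.mpr h), Int.cast_one]; decide
  · rw [if_neg h, if_neg (fun h' => h (h2.mp h')), add_zero]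

/-- **`parVec` is invariant under Galois translation.** [folklore] -/
theorem parVec_transl (g : ZMod 4 × B) (v : Ty B → ℤ) : parVec B (transl B g v) = parVec B v := by
  funext ω
  rw [parVec_apply, parVec_apply]
  refine Finset.sum_bij (fun s _ => tw B (-g) s) (fun s hs => (tw_mem_orbSet_iff B (-g)).mpr hs) ?_ ?_ (fun s _ => rfl)
  · intro s₁ _ s₂ _ h
    have := congrArg (tw B g) h
    rwa [tw_tw_neg, tw_tw_neg] at this
  · intro s hs
    exact ⟨tw B g s, (tw_mem_orbSet_iff B g).mpr hs, tw_neg_tw B g s⟩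

/-- **The parities of `pairs ⊔ ℤ[G]·S` lie in the `𝔽₂`-span of the parities of `S`.** [folklore] -/
theorem parVec_mem_span_of_mem (S : Finset (Ty B → ℤ)) {m : Ty B → ℤ}
    (hm : m ∈ pairs B ⊔ Submodule.span ℤ {w : Ty B → ℤ | ∃ g : ZMod 4 × B, ∃ v ∈ S, w = transl B g v}) :
    parVec B m ∈ Submodule.span (ZMod 2) ((S.image (parVec B) : Finset _) : Set (Orb B → ZMod 2)) := by
  set T := Submodule.span (ZMod 2) ((S.image (parVec B) : Finset _) : Set (Orb B → ZMod 2)) with hT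
  have hle : pairs B ⊔ Submodule.span ℤ {w : Ty B → ℤ | ∃ g : ZMod 4 × B, ∃ v ∈ S, w = transl B g v} ≤
      (T.restrictScalars ℤ).comap (parVec B) := by
    refine sup_le (Submodule.span_le.mpr ?_) (Submodule.span_le.mpr ?_)
    · rintro _ ⟨ψ, rfl⟩
      show parVec B (pairVec B ψ) ∈ T
      rw [parVec_pairVec]; exact T.zero_mem
    · rintro _ ⟨g, v, hv, rfl⟩
      show parVec B (transl B g v) ∈ T
      rw [parVec_transl]
      exact Submodule.subset_span (Finset.mem_coe.mpr (Finset.mem_image_of_mem _ hv))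
  exact hle hm

/-! ## §2 Parities of the residual vectors and of the squares -/

/-- Blocks of constant types: all equal to the block of `cst 0 = atom 0 b₀ 0`. [folklore] -/
theorem cst_mem_orbSet_iff (b₀ : B) (u : ZMod 4) (ω : Orb B) :
    cst B u ∈ orbSet B ω ↔ ω = Quotient.mk (orbitRel B) (atom B 0 b₀ 0) := by
  rw [mem_orbSet, ← atom_zero B u b₀, mk_atom_eq B b₀]; exact eq_comm

/-- Blocks of atoms: the block of `atom 0 b₀ k` of the same kind. [folklore] -/
theorem atom_mem_orbSet_iff (b₀ : B) (u : ZMod 4) (b : B) (k : ZMod 4) (ω : Orb B) :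
    atom B u b k ∈ orbSet B ω ↔ ω = Quotient.mk (orbitRel B) (atom B 0 b₀ k) := by
  rw [mem_orbSet, mk_atom_eq B b₀]; exact eq_comm

/-- **Parity of the column face at `cst 0`** at a block `ω`. [folklore] -/
theorem parVec_colface_apply (b₀ : B) (ω : Orb B) :
    parVec B (faceVec B (cst B 0) (0, b₀) (1, b₀)) ω =
      (if ω = Quotient.mk (orbitRel B) (atom B 0 b₀ 0) then 1 else 0) - (if ω = Quotient.mk (orbitRel B) (atom B 0 b₀ 1) then 1 else 0)
      - (if ω = Quotient.mk (orbitRel B) (atom B 0 b₀ (-1)) then 1 else 0) + (if ω = Quotient.mk (orbitRel B) (atom B 0 b₀ 2) then 1 else 0) := by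
  have hst : step 0 0 = 1 := by decide
  rw [faceVec_cst_column, hst, map_add, map_sub, map_sub, Pi.add_apply, Pi.sub_apply, Pi.sub_apply, parVec_single, parVec_single,
    parVec_single, parVec_single]
  simp only [cst_mem_orbSet_iff B b₀, atom_mem_orbSet_iff B b₀, Int.cast_one]

/-- **Parity of `X_{0,b₀}`** at a block `ω`. [folklore] -/
theorem parVec_Xvec_apply (b₀ : B) (ω : Orb B) :
    parVec B (Xvec B 0 b₀) ω = (if ω = Quotient.mk (orbitRel B) (atom B 0 b₀ 1) then 1 else 0)
      + (if ω = Quotient.mk (orbitRel B) (atom B 0 b₀ (-1)) then 1 else 0) - (if ω = Quotient.mk (orbitRel B) (atom B 0 b₀ 0) then 1 else 0)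
      - (if ω = Quotient.mk (orbitRel B) (atom B 0 b₀ 0) then 1 else 0) := by
  unfold Xvec
  rw [map_sub, map_sub, map_add, Pi.sub_apply, Pi.sub_apply, Pi.add_apply, parVec_single, parVec_single, parVec_single, parVec_single]
  simp only [atom_mem_orbSet_iff B b₀, cst_mem_orbSet_iff B b₀, Int.cast_one]

/-- **Parity of `w_1`** at a block `ω`. [folklore] -/
theorem parVec_Wvec_apply (b₀ : B) (ω : Orb B) :
    parVec B (Wvec B 1) ω = (Fintype.card B : ZMod 2) * (if ω = Quotient.mk (orbitRel B) (atom B 0 b₀ (-1)) then 1 else 0)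
      - ((Fintype.card B : ℤ) - 1 : ℤ) • (if ω = Quotient.mk (orbitRel B) (atom B 0 b₀ 0) then (1 : ZMod 2) else 0)
      - (if ω = Quotient.mk (orbitRel B) (atom B 0 b₀ 0) then 1 else 0) := by
  unfold Wvec
  rw [map_sub, map_sub, map_smul, map_sum, Pi.sub_apply, Pi.sub_apply, Pi.smul_apply, Finset.sum_apply, parVec_single, parVec_single,
    sub_self]
  have h : ∀ b : B, parVec B (Pi.single (atom B 1 b (-1)) (1 : ℤ)) ω = if ω = Quotient.mk (orbitRel B) (atom B 0 b₀ (-1)) then 1 else 0 := by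
    intro b; rw [parVec_single]; simp only [atom_mem_orbSet_iff B b₀, Int.cast_one]
  rw [Finset.sum_congr rfl (fun b _ => h b), Finset.sum_const, Finset.card_univ, nsmul_eq_mul]
  simp only [cst_mem_orbSet_iff B b₀, Int.cast_one]

/-- The parity vector of a `Φ`-decreasing square through `s`: `1` on the block of `s`, `0` on every other block of potential `≥ Φ s`.
[folklore] -/
theorem parVec_goodSquare {s : Ty B} {p q : ZMod 2 × B} (h1 : Phi B (flip B p s) < Phi B s) (h2 : Phi B (flip B q s) < Phi B s)
    (h12 : Phi B (flip B q (flip B p s)) < Phi B s) (ω : Orb B) (hω : ∀ s' ∈ orbSet B ω, Phi B s ≤ Phi B s') :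
    parVec B (faceVec B s p q) ω = if s ∈ orbSet B ω then 1 else 0 := by
  have out : ∀ {t : Ty B}, Phi B t < Phi B s → t ∉ orbSet B ω := fun ht htω => absurd (hω _ htω) (not_le.mpr ht)
  unfold faceVec
  rw [map_add, map_sub, map_sub, Pi.add_apply, Pi.sub_apply, Pi.sub_apply, parVec_single, parVec_single, parVec_single,
    parVec_single, if_neg (out h1), if_neg (out h2), if_neg (out h12), Int.cast_one]
  split_ifs <;> ring

/-! ## §3 The law -/

/-- **THE LAW (lower bound).**  If a finite family `S` of exponent vectors generates the Hodge lattice of the quartic twist together with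
the pairs and all Galois translates, then `β ≤ |S| + 1` (`|B|` odd `≥ 3`; `β = Fintype.card (Orb B)`). [folklore] -/
theorem card_orb_le_card_add_one (hB : Odd (Fintype.card B)) (h3 : 3 ≤ Fintype.card B) (S : Finset (Ty B → ℤ))
    (hS : hodge B ≤ pairs B ⊔ Submodule.span ℤ {w : Ty B → ℤ | ∃ g : ZMod 4 × B, ∃ v ∈ S, w = transl B g v}) :
    Fintype.card (Orb B) ≤ S.card + 1 := by
  classical
  obtain ⟨b₀⟩ : Nonempty B := Fintype.card_pos_iff.mp (by omega)
  set T := Submodule.span (ZMod 2) ((S.image (parVec B) : Finset _) : Set (Orb B → ZMod 2)) with hT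
  have hT' : Module.finrank (ZMod 2) T ≤ S.card := (finrank_span_finset_le_card _).trans Finset.card_image_le
  -- one `Φ`-decreasing square per non-residual block
  have hsq : ∀ ω : Orb B, ∃ pq : (ZMod 2 × B) × (ZMod 2 × B), ¬ IsRes B ω.out →
      (pq.1.2 ≠ pq.2.2 ∧ Phi B (flip B pq.1 ω.out) < Phi B ω.out ∧ Phi B (flip B pq.2 ω.out) < Phi B ω.out ∧
        Phi B (flip B pq.2 (flip B pq.1 ω.out)) < Phi B ω.out) := by
    intro ω
    by_cases h : IsRes B ω.out
    · exact ⟨((0, b₀), (0, b₀)), fun h' => (h' h).elim⟩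
    · obtain ⟨p, q, hpq⟩ := exists_goodSquare B h3 h
      exact ⟨(p, q), fun _ => hpq⟩
  choose pq hpq using hsq
  -- the residual blocks
  set ωc : Orb B := Quotient.mk (orbitRel B) (atom B 0 b₀ 0) with hωc
  set ωp : Orb B := Quotient.mk (orbitRel B) (atom B 0 b₀ 1) with hωp
  set ωm : Orb B := Quotient.mk (orbitRel B) (atom B 0 b₀ (-1)) with hωm
  set ω2 : Orb B := Quotient.mk (orbitRel B) (atom B 0 b₀ 2) with hω2
  have n10 : ωp ≠ ωc := mk_atom_ne B h3 b₀ (by decide) (by decide)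
  have nm0 : ωm ≠ ωc := mk_atom_ne B h3 b₀ (by decide) (by decide)
  have n20 : ω2 ≠ ωc := mk_atom_ne B h3 b₀ (by decide) (by decide)
  have n1m : ωp ≠ ωm := mk_atom_ne B h3 b₀ (by decide) (by decide)
  have n12 : ωp ≠ ω2 := mk_atom_ne B h3 b₀ (by decide) (by decide)
  have nm2 : ωm ≠ ω2 := mk_atom_ne B h3 b₀ (by decide) (by decide)
  -- the index type and the vectors
  let NRt := {ω : Orb B // ¬ IsRes B ω.out}
  have resb : ∀ (ω : NRt) (k : ZMod 4), (ω.1 : Orb B) ≠ Quotient.mk (orbitRel B) (atom B 0 b₀ k) := by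
    intro ω k h
    apply ω.2
    have hrel : (orbitRel B).r ω.1.out (atom B 0 b₀ k) := Quotient.exact (by rw [Quotient.out_eq]; exact h)
    exact (isRes_iff_of_rel B hrel).mpr ⟨0, b₀, k, rfl⟩
  let vec : Option (Option (Option NRt)) → (Ty B → ℤ) := fun x =>
    match x with
    | none => faceVec B (cst B 0) (0, b₀) (1, b₀)
    | some none => Xvec B 0 b₀
    | some (some none) => Wvec B 1
    | some (some (some ω)) => faceVec B ω.1.out (pq ω.1).1 (pq ω.1).2
  have hvecH : ∀ x, vec x ∈ hodge B := by
    rintro (_ | _ | _ | ω)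
    · exact faceVec_mem B _ (fun h => (zero_ne_one (α := ZMod 2)) (congrArg Prod.fst h))
    · exact Xvec_mem B 0 b₀
    · exact Wvec_mem B 1
    · exact faceVec_mem B _ (fun h => (hpq ω.1 ω.2).1 (congrArg Prod.snd h))
  have hmem : ∀ x, parVec B (vec x) ∈ T := fun x => parVec_mem_span_of_mem B S (hS (hvecH x))
  -- values of the three residual parities at the residual blocks, and vanishing at non-residual blocks
  have vcol : ∀ ω : Orb B, parVec B (vec none) ω = (if ω = ωc then 1 else 0) - (if ω = ωp then 1 else 0) - (if ω = ωm then 1 else 0)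
      + (if ω = ω2 then 1 else 0) := fun ω => parVec_colface_apply B b₀ ω
  have vX : ∀ ω : Orb B, parVec B (vec (some none)) ω = (if ω = ωp then 1 else 0) + (if ω = ωm then 1 else 0) - (if ω = ωc then 1 else 0)
      - (if ω = ωc then 1 else 0) := fun ω => parVec_Xvec_apply B b₀ ω
  have vW : ∀ ω : Orb B, parVec B (vec (some (some none))) ω = (Fintype.card B : ZMod 2) * (if ω = ωm then 1 else 0)
      - ((Fintype.card B : ℤ) - 1 : ℤ) • (if ω = ωc then (1 : ZMod 2) else 0) - (if ω = ωc then 1 else 0) :=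
    fun ω => parVec_Wvec_apply B b₀ ω
  have hodd2 : (Fintype.card B : ZMod 2) = 1 := by
    obtain ⟨m, hm⟩ := hB
    rw [hm]; push_cast; rw [show (2 : ZMod 2) = 0 by decide]; ring
  -- linear independence
  have hli : LinearIndependent (ZMod 2) (fun x => parVec B (vec x)) := by
    rw [Fintype.linearIndependent_iff]
    intro g hsum
    have heval : ∀ ω : Orb B, g none * parVec B (vec none) ω + (g (some none) * parVec B (vec (some none)) ω
        + (g (some (some none)) * parVec B (vec (some (some none))) ω
          + ∑ ωn : NRt, g (some (some (some ωn))) * parVec B (vec (some (some (some ωn)))) ω)) = 0 := by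
      intro ω
      have h := congrFun hsum ω
      rw [Finset.sum_apply, Fintype.sum_option, Fintype.sum_option, Fintype.sum_option] at h
      simpa only [Pi.smul_apply, smul_eq_mul, Finset.sum_apply, Pi.zero_apply] using h
    -- (a) the non-residual coefficients vanish
    have hnr : ∀ ωn : NRt, g (some (some (some ωn))) = 0 := by
      by_contra hne
      obtain ⟨ω₁, hω₁⟩ := not_forall.mp hne
      obtain ⟨ω₀, hω₀, hmax⟩ := Finset.exists_max_image (univ.filter fun ωn : NRt => g (some (some (some ωn))) ≠ 0)
        (fun ωn => Phi B ωn.1.out) ⟨ω₁, mem_filter.mpr ⟨mem_univ _, hω₁⟩⟩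
      have hg₀ : g (some (some (some ω₀))) ≠ 0 := (mem_filter.mp hω₀).2
      have hs₀ : ω₀.1.out ∈ orbSet B ω₀.1 := (mem_orbSet B).mpr (Quotient.out_eq _)
      have hω₀Phi : ∀ s' ∈ orbSet B ω₀.1, Phi B ω₀.1.out ≤ Phi B s' := fun s' hs' => (Phi_eq_of_mem_orbSet B hs₀ hs').le
      have h := heval ω₀.1
      rw [vcol, vX, vW, if_neg (resb ω₀ 0), if_neg (resb ω₀ 1), if_neg (resb ω₀ (-1)), if_neg (resb ω₀ 2)] at h
      have hterm : ∀ ωn : NRt, g (some (some (some ωn))) * parVec B (vec (some (some (some ωn)))) ω₀.1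
          = if ωn = ω₀ then g (some (some (some ω₀))) else 0 := by
        intro ωn
        by_cases hgn : g (some (some (some ωn))) = 0
        · rw [hgn, zero_mul]; split_ifs with h' <;> [rw [← h', hgn]; rfl]
        · have hle : Phi B ωn.1.out ≤ Phi B ω₀.1.out := hmax ωn (mem_filter.mpr ⟨mem_univ _, hgn⟩)
          obtain ⟨-, q1, q2, q12⟩ := hpq ωn.1 ωn.2
          have hφ : ∀ s' ∈ orbSet B ω₀.1, Phi B ωn.1.out ≤ Phi B s' := fun s' hs' => hle.trans (hω₀Phi s' hs')
          rw [show vec (some (some (some ωn))) = faceVec B ωn.1.out (pq ωn.1).1 (pq ωn.1).2 from rfl,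
            parVec_goodSquare B q1 q2 q12 ω₀.1 hφ]
          by_cases hωω : ωn = ω₀
          · subst hωω; rw [if_pos hs₀, if_pos rfl, mul_one]
          · have hnot : ωn.1.out ∉ orbSet B ω₀.1 := by
              intro hin
              exact hωω (Subtype.ext (((mem_orbSet B).mp hin).symm ▸ (Quotient.out_eq ωn.1).symm ▸ rfl))
            rw [if_neg hnot, if_neg hωω, mul_zero]
      rw [Finset.sum_congr rfl (fun ωn _ => hterm ωn), Finset.sum_ite_eq' univ ω₀, if_pos (mem_univ _)] at h
      simp only [mul_zero, smul_zero, sub_self, add_zero, zero_add] at h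
      exact hg₀ h
    have hrest : ∀ ω : Orb B, g none * parVec B (vec none) ω + (g (some none) * parVec B (vec (some none)) ω
        + g (some (some none)) * parVec B (vec (some (some none))) ω) = 0 := by
      intro ω
      have h := heval ω
      rw [Finset.sum_eq_zero (fun ωn _ => by rw [hnr ωn, zero_mul]), add_zero] at h
      exact h
    -- (b) evaluate at the blocks of `2δ`, `+δ`, `−δ`
    have e2 : g none = 0 := by
      have h := hrest ω2
      rw [vcol, vX, vW] at h
      simpa [n20, n12.symm, nm2.symm] using h
    have ep : g (some none) = 0 := by
      have h := hrest ωp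
      rw [vcol, vX, vW, e2] at h
      simpa [n10, n1m, n12] using h
    have em : g (some (some none)) = 0 := by
      have h := hrest ωm
      rw [vcol, vX, vW, e2, ep, hodd2] at h
      simpa [nm0, n1m.symm, nm2] using h
    rintro (_ | _ | _ | ω)
    · exact e2
    · exact ep
    · exact em
    · exact hnr ω
  -- count
  have hli' : LinearIndependent (ZMod 2) (fun x => (⟨_, hmem x⟩ : T)) := LinearIndependent.of_comp T.subtype hli
  have hcard := hli'.fintype_card_le_finrank
  simp only [Fintype.card_option] at hcard
  have hNR : Fintype.card NRt = (univ.filter fun ω : Orb B => ¬ IsRes B ω.out).card := Fintype.card_subtype _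
  have hres : (univ.filter fun ω : Orb B => IsRes B ω.out).card ≤ 4 := by
    have hsub : (univ.filter fun ω : Orb B => IsRes B ω.out) ⊆ {ωc, ωp, ωm, ω2} := by
      intro ω hω
      obtain ⟨u, b, k, hk⟩ := (mem_filter.mp hω).2
      have hω' : ω = Quotient.mk (orbitRel B) (atom B 0 b₀ k) := by rw [← Quotient.out_eq ω, hk, mk_atom_eq B b₀]
      simp only [mem_insert, mem_singleton]
      have key : ∀ k : ZMod 4, k = 0 ∨ k = 1 ∨ k = -1 ∨ k = 2 := by decide
      rcases key k with rfl | rfl | rfl | rfl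
      · exact Or.inl hω'
      · exact Or.inr (Or.inl hω')
      · exact Or.inr (Or.inr (Or.inl hω'))
      · exact Or.inr (Or.inr (Or.inr hω'))
    exact (Finset.card_le_card hsub).trans Finset.card_le_four
  have htot := Finset.card_filter_add_card_filter_not (s := (univ : Finset (Orb B))) (fun ω : Orb B => IsRes B ω.out)
  rw [Finset.card_univ] at htot
  omega

/-- **THE QUARTIC-TWIST LAW** (`|B|` odd, `≥ 3`).  (i) There is a family of `β − 1` rank-four faces whose Galois translates generate the
Hodge lattice of the quartic twist `(ℤ/4 × B, (2,0))` modulo the pairs, and (ii) no family of fewer exponent vectors of any kind does: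
`μ(ℤ/4 × B) = β − 1` EXACTLY. [folklore] -/
theorem quarticTwist_law_eq (hB : Odd (Fintype.card B)) (h3 : 3 ≤ Fintype.card B) :
    (∃ S : Finset (Ty B × (ZMod 2 × B) × (ZMod 2 × B)), (∀ f ∈ S, f.2.1 ≠ f.2.2) ∧ hodge B ≤ pairs B ⊔ spanFaces B S ∧
        S.card + 1 = Fintype.card (Orb B)) ∧
      ∀ S : Finset (Ty B → ℤ),
        hodge B ≤ pairs B ⊔ Submodule.span ℤ {w : Ty B → ℤ | ∃ g : ZMod 4 × B, ∃ v ∈ S, w = transl B g v} →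
        Fintype.card (Orb B) ≤ S.card + 1 :=
  ⟨exists_faces_generate B hB h3, fun S hS => card_orb_le_card_add_one B hB h3 S hS⟩

end Summit.HodgeConjecture.CorCM.Census.QuarticTwist
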